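import Summits.Ventures.AbcSig.Rows.Statements
import HarnessLib.Audit.Tags

/-!
# Venture AbcSig — CONJECTURE `CONJ_LR128_L1` (level-raising ghosts at the levels `2⁷·ℓ`), TYPED per STANDING RULE (5)

HONEST FRAMING. This file states a CONJECTURE of the computation cell `pub-abcsig` about the OUTPUT OF THE MODULAR METHOD
(which newforms of level `2⁷ℓ` survive the [BS04, Lemma 4.2] trace sieve modulo `n`), as a Lean `Prop` with its evidence
ledger in this docstring. It is NOT a theorem, nothing is proved about it here, and it makes no claim on ABC or any summit.
It is filed because the coordinator's STANDING RULE (5) (2026-08-22T21:27:43Z) triggered: the conjecture survived THREE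
pre-registered instance predictions (lead RULE-5 TRIGGER, HOME/INBOX 2026-08-23T07:35:01Z).

STATEMENT (HOME/lead/CONJ-LEAN-SPEC.md, sha16 c91dee6202550e66, §CONJ_LR128_L1 WITH AMENDMENT A1; sketch
HOME/lead/spec/ConjSketch.lean 5d44b17f10b6ab51). Let `E₁₂₈ : y² = x³ − x² − 2x + 2` (conductor 128; the Frey curve of the
pseudo-solution `−1 + 2 = 1`) with traces `a128 ℓ`, and let `a ∈ {a128, χ₋₄·a128, χ₈·a128, χ₋₈·a128}` range over the eigenvalue
systems of the FOUR newforms of level 128 (`E₁₂₈` and its quadratic twists by the characters of conductor dividing 8 —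
AMENDMENT A1: the source is SOME member of this Klein-four class, not `E₁₂₈` alone). For primes `ℓ ≥ 3` and `n ≥ 11`,
`n ≠ ℓ`, satisfying Ribet's level-raising condition `n ∣ (ℓ + 1)² − a128(ℓ)²`, SOME newform `f` of level `2⁷·ℓ` is congruent
modulo a prime above `n` to one of these four systems at every odd prime `q ∤ 2⁷ℓ` AND passes the coarse trace sieve
(`M.ArisesMod f n bs04Allowed`, [BS04, Lemma 4.2]) — i.e. it is a "ghost" that no trace sieve can remove.
Existence direction in print: [Rib90b, Thm 1] (K. Ribet, *Raising the levels of modular representations*, Sémin. Théor.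
Nombres Paris 1987–88, Progr. Math. 81 (1990) 259–271, Thm 1) / Diamond–Taylor: the congruent newform of level `2⁷ℓ` EXISTS
under the level-raising condition; that it then passes the [BS04] coarse sets is the cell's THEORY TASK T2(ii) (HOME/STRUCTURE.md).

EVIDENCE LEDGER (pre-registered instance predictions P-E2G4-1 of engine-2 g4, scored on engine-1 level files of record;
HOME/lead/PREDICTIONS-LR128-lead.md ADDENDUM-3, sha16 183e8eb8cf755e16): ℓ = 79 (N = 10112): HIT; ℓ = 89 (N = 11392): HIT
(instances (89; 11), (89; 23)); ℓ = 83 (N = 10624, blind: engine-2 kit j187210 + lead re-score at 0 kit): HIT — R128(83) = {13}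
from 7020 = 2²·3³·5·13, residual at n ≥ 11 = {13} exactly, carriers 10624.17/.18/.19/.20 (degree 23) ≡ E⊗χ₈ / E⊗χ₋₄ / E⊗χ₋₈ / E
at 44/44 good primes; P10 / P10⁺ / P12 / P14(a) / P15(a) HIT. 0 MISS. In-sample: the α = 1 cells of the census.

WHAT THE TYPED DECLARATION CARRIES (lead note R1, HOME/lead/CONJ-LEAN-SPEC.md TRIGGER LOG 2026-08-23T13:26Z; referee ref-g35's
reading of the sister declaration `CONJ_LR32_L1`, HOME/referee/lr32-l1-g35/REF-READ-CONJ_LR32_L1-g35.md 732e25b7dcf5403a). As typed,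
`CONJ_LR128_L1` is the EXISTENCE clause — in substance [Rib90b, Thm 1] / [DT94, Thm A] level raising read in this model (with
N(ρ̄_{E₁₂₈,n}) = 128): the conjunct `M.ArisesMod f n bs04Allowed` is implied by `CongruentTo M f n (a128tw i)` with the same `ψ`,
because `a_q(E₁₂₈)` is even (rational `2`-torsion point `(1, 0)`) with `a_q² ≤ 4q` (Hasse) and the four twists only change signs,
so `a128tw i q ∈ bs04Allowed q` at every odd prime `q`. This is now a THEOREM of the tree, with no residual hypothesis:
`Conjectures/LevelRaising128Hasse.lean` (p-lean g7) proves `a128tw_mem_bs04Allowed` (Hasse from the tree's Literature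
`HasseElementary`, Manin/Knapp) and `CONJ_LR128_L1_iff_exists : CONJ_LR128_L1 M ↔ ∀ ℓ n …, LevelRaise a128 ℓ n →
∃ i f, CongruentTo M f n (a128tw i)`. The empirical content of CONJ-LR (which newforms survive, multiplicities) stays in
the docstrings / HOME/STRUCTURE.md, untyped.

The arithmetic layer (`apCubic`, `a128`, the characters, `LevelRaise`) is model-free and computable; the model layer
(`CongruentTo`, the conjecture) is phrased over the cell's abstract `NewformModel` (`Recipes/BS04.lean`) and, like every row of
the cell, is MEANINGFUL ONLY FOR THE INTENDED MODEL (newforms of weight 2, trivial character, their Hecke eigenvalues).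
-/

namespace Summit.Ventures.AbcSig.Conjectures

open Summit.Ventures.AbcSig

/-! ## Arithmetic layer (model-free, computable) -/

/-- Number of `y (mod ℓ)` with `y² ≡ x³ + c₂x² + c₁x + c₀ (mod ℓ)`; coefficients given as residues in `ℕ`. -/
def nsqCubic (ℓ c₂ c₁ c₀ x : ℕ) : ℕ :=
  ((Finset.range ℓ).filter (fun y => (y * y) % ℓ = (x ^ 3 + c₂ * x ^ 2 + c₁ * x + c₀) % ℓ)).card

/-- Naive trace of Frobenius `a_ℓ = ℓ − Σ_x N(x)` of `y² = x³ + c₂x² + c₁x + c₀` at a prime `ℓ` of good reduction. -/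
def apCubic (ℓ c₂ c₁ c₀ : ℕ) : ℤ :=
  (ℓ : ℤ) - ∑ x ∈ Finset.range ℓ, (nsqCubic ℓ c₂ c₁ c₀ x : ℤ)

/-- `a_ℓ(E₁₂₈)`, `E₁₂₈ : y² = x³ − x² − 2x + 2` (conductor 128; the Frey curve of the pseudo-solution `−1 + 2 = 1`),
for an odd prime `ℓ` (the residues `ℓ − 1`, `ℓ − 2` encode the coefficients `−1`, `−2`). -/
def a128 (ℓ : ℕ) : ℤ := apCubic ℓ (ℓ - 1) (ℓ - 2) 2

/-- The quadratic character `χ₋₄ = (−4/·)` on odd numbers: `+1` if `q ≡ 1 (mod 4)`, `−1` if `q ≡ 3 (mod 4)` (`0` on even `q`). -/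
def chiNeg4 (q : ℕ) : ℤ := if q % 2 = 0 then 0 else if q % 4 = 1 then 1 else -1

/-- The quadratic character `χ₈ = (8/·) = (2/·)` on odd numbers: `+1` if `q ≡ ±1 (mod 8)`, `−1` if `q ≡ ±3 (mod 8)`. -/
def chi8 (q : ℕ) : ℤ := if q % 2 = 0 then 0 else if q % 8 = 1 ∨ q % 8 = 7 then 1 else -1

/-- The quadratic character `χ₋₈ = (−8/·) = (−2/·)` on odd numbers: `+1` if `q ≡ 1, 3 (mod 8)`, `−1` if `q ≡ 5, 7 (mod 8)`. -/
def chiNeg8 (q : ℕ) : ℤ := if q % 2 = 0 then 0 else if q % 8 = 1 ∨ q % 8 = 3 then 1 else -1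

/-- AMENDMENT A1 — the four candidate sources: the eigenvalue systems of the four newforms of level 128, i.e. `E₁₂₈` and its
quadratic twists by `χ₋₄`, `χ₈`, `χ₋₈` (index `0, 1, 2, 3`). -/
def a128tw (i : Fin 4) (q : ℕ) : ℤ :=
  match i with
  | ⟨0, _⟩ => a128 q
  | ⟨1, _⟩ => chiNeg4 q * a128 q
  | ⟨2, _⟩ => chi8 q * a128 q
  | ⟨3, _⟩ => chiNeg8 q * a128 q

/-- Ribet's level-raising condition for the source `a` at `ℓ` modulo `n`: `n ∣ (ℓ + 1)² − a(ℓ)²` (the same for all four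
twists, since `χ(ℓ)² = 1`). -/
def LevelRaise (a : ℕ → ℤ) (ℓ n : ℕ) : Prop := (n : ℤ) ∣ ((ℓ : ℤ) + 1) ^ 2 - a ℓ ^ 2

/-- `LevelRaise a ℓ n` is decidable (an integer divisibility). -/
instance (a : ℕ → ℤ) (ℓ n : ℕ) : Decidable (LevelRaise a ℓ n) := by unfold LevelRaise; infer_instance

/-- Sanity value (the T-BS13 cell (19; 1)): `a₁₉(E₁₂₈) = 2` and `11 ∣ 20² − 2² = 396`. -/
example : a128 19 = 2 ∧ LevelRaise a128 19 11 := by decide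

/-! ## Model-language layer (over the cell's abstract `NewformModel`; MEANINGFUL ONLY FOR THE INTENDED MODEL) -/

/-- "`f` of level `N` is congruent, modulo a prime of residue characteristic `n`, to the system of eigenvalues `a` at every
odd prime `q ∤ N`": a ring homomorphism `ψ : Coeff f → k` into a field of characteristic `n` with `ψ(c_q(f)) = a(q)`
(intended: `f ≡` the `ℓ`-stabilisation of the source form, all good odd primes). -/
def CongruentTo (M : NewformModel) {N : ℕ} (f : M.Form N) (n : ℕ) (a : ℕ → ℤ) : Prop :=
  ∃ (k : Type) (_ : Field k) (_ : CharP k n) (ψ : M.Coeff N f →+* k),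
    ∀ q : ℕ, q.Prime → q ≠ 2 → ¬ q ∣ N → ψ (M.eig N f q) = ((a q : ℤ) : k)

/-- **CONJECTURE `CONJ_LR128_L1` (level-raising ghosts, α = 1; engine-2 g4, amended A1 by the lead) — NOT A THEOREM.**
For primes `ℓ ≥ 3` and `n ≥ 11` with `n ≠ ℓ` and `n ∣ (ℓ + 1)² − a_ℓ(E₁₂₈)²`, some newform `f` of level `2⁷·ℓ` is congruent
modulo a prime above `n` to one of the four level-128 eigenvalue systems `a128tw i` at all odd primes `q ∤ 2⁷ℓ`, and passes
the coarse [BS04, Lemma 4.2] trace sieve modulo `n` (`M.ArisesMod f n bs04Allowed`). Evidence and literature: module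
docstring (three pre-registered instance predictions HIT, 0 MISS; existence half = [Rib90b, Thm 1]). Typed per STANDING
RULE (5); no proof obligation is claimed or attempted. -/
@[conjecture] def CONJ_LR128_L1 (M : NewformModel) : Prop :=
  ∀ ℓ n : ℕ, ℓ.Prime → 3 ≤ ℓ → n.Prime → 11 ≤ n → n ≠ ℓ → LevelRaise a128 ℓ n →
    ∃ i : Fin 4, ∃ f : M.Form (2 ^ 7 * ℓ), CongruentTo M f n (a128tw i) ∧ M.ArisesMod f n bs04Allowed

end Summit.Ventures.AbcSig.Conjectures
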